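import Summits.ResolutionOfSingularities.ResolutionOfSingularities.Theorems.WeightedInvariantDatumToEmbedded
import Summits.ResolutionOfSingularities.ResolutionOfSingularities.Theorems.WeightedInvariantDatumToResolution
import HarnessLib

/-!
# Crux `WeightedThesis` (stmt-ResolutionOfSingularities-0569) modulo `WeightedConstruction` and Bergh–Rydh

Topic: `Summits/ResolutionOfSingularities/ResolutionOfSingularities/Theorems`. Route
`ResolutionOfSingularities/WeightedInvariant`, crux `Theses.WeightedInvariant.WeightedThesis` (the
resolution conjecture for reduced separated schemes of finite type over PERFECT fields of
characteristic `p`, every prime `p`), line `datum-glued-split`, lead c4 (RESHAPE 5).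

The sharpest conditional form of the crux the tree now supports, assembled from two landed pieces:

* `datumToEmbedded_of_berghRydh2019` (`Theorems/WeightedInvariantDatumToEmbedded.lean`, crux
  stmt-0572 modulo the named fact): a weighted resolution datum in characteristic `p`
  (`WeightedResolutionDatum p`, Włodarczyk arXiv:2203.03090 / Abramovich–Temkin–Włodarczyk 2024)
  resolves every integral closed subscheme of every smooth separated quasi-compact scheme over every
  perfect field of characteristic `p`, GRANTED Bergh–Rydh's resolution of finite diagonalizable
  quotient singularities (`BerghRydh2019_diagonalizableQuotientResolution`, arXiv:1905.00872 Thm 5,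
  a published theorem recorded as a named fact in
  `Literature/AlgebraicGeometry/Resolution/TameQuotientSingularitiesResolution.lean`);
* `datumToResolution_of_datumToEmbedded` (`Theorems/WeightedInvariantDatumToResolution.lean`,
  support stmt-8974): embedded resolution of the integral closed subschemes of the projective spaces
  spreads to every reduced separated scheme of finite type (irreducible components, Chow's lemma,
  projective closure).

Consequences recorded here (all sorry-free, CONDITIONAL on the hypotheses named in each signature):
`datumToResolution_of_berghRydh2019 : BerghRydh2019_… → DatumToResolution`; prime by prime,
`hasResolution_of_berghRydh2019_of_datum` (one datum at one prime `p` resolves everything reduced,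
separated and of finite type over every perfect field of characteristic `p`);
`weightedThesis_of_berghRydh2019 : BerghRydh2019_… → WeightedConstruction → WeightedThesis` — so the
crux's residue is EXACTLY the route's construction crux `WeightedConstruction` (stmt-0571, the open
problem: a weighted resolution datum exists in every characteristic) plus one published theorem; and
`resolutionOfSingularities_of_berghRydh2019`, the summit from the same two hypotheses and the shared
descent crux `DescentPerfectToAll` (stmt-0549), through the route's deciding theorem `closes`.
-/

noncomputable section

open CategoryTheory AlgebraicGeometry
open Literature.AlgebraicGeometry.Resolution
open Summit.ResolutionOfSingularities.ResolutionOfSingularities.Theses.WeightedInvariant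

set_option linter.dupNamespace false -- mandated namespace of this single-conjunct summit

namespace Summit.ResolutionOfSingularities.ResolutionOfSingularities.Theorems

/-- **Datum ⇒ resolution over perfect fields, modulo Bergh–Rydh**: granted Bergh–Rydh's resolution of
finite diagonalizable quotient singularities, a weighted resolution datum in characteristic `p`
resolves every reduced separated scheme of finite type over every perfect field of characteristic
`p` (the route's support `DatumToResolution`, stmt-8974). Composition of
`datumToEmbedded_of_berghRydh2019` (crux stmt-0572 modulo the fact) with
`datumToResolution_of_datumToEmbedded` (projective reduction).
[cite: Wlodarczyk2022, Thm 1.1.6; BerghRydh2019, Thm 5; CossartPiltant2019, Prop. 4.6 (proof, Steps 1–3)] -/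
theorem datumToResolution_of_berghRydh2019 : Literature.AlgebraicGeometry.Resolution.BerghRydh2019_diagonalizableQuotientResolution → Summit.ResolutionOfSingularities.ResolutionOfSingularities.Theses.WeightedInvariant.DatumToResolution :=
  fun hBR => datumToResolution_of_datumToEmbedded (datumToEmbedded_of_berghRydh2019 hBR)

/-- **One datum at one prime suffices at that prime** (modulo Bergh–Rydh): if
`BerghRydh2019_diagonalizableQuotientResolution` holds and `D` is a weighted resolution datum in
characteristic `p`, then every reduced separated scheme of finite type over a perfect field of
characteristic `p` admits a resolution of singularities. The prime-by-prime form of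
`datumToResolution_of_berghRydh2019`, convenient for constructions of the datum one characteristic
at a time. [cite: Wlodarczyk2022, Thm 1.1.6; BerghRydh2019, Thm 5] -/
theorem hasResolution_of_berghRydh2019_of_datum
    (hBR : BerghRydh2019_diagonalizableQuotientResolution) {p : ℕ} (hp : p.Prime)
    (D : WeightedResolutionDatum p) (k : Type) [Field k] [CharP k p] [PerfectField k]
    (X : Scheme.{0}) (f : X ⟶ Spec (.of k)) [IsSeparated f] [LocallyOfFiniteType f]
    [QuasiCompact f] [IsReduced X] : Scheme.HasResolution X :=
  datumToResolution_of_berghRydh2019 hBR p hp ⟨D⟩ k X f ‹_› ‹_› ‹_› ‹_›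

/-- **The crux `WeightedThesis` modulo `WeightedConstruction` and Bergh–Rydh**: granted Bergh–Rydh's
resolution of finite diagonalizable quotient singularities (published, arXiv:1905.00872 Thm 5) and
the route's construction crux `WeightedConstruction` (stmt-0571: a weighted resolution datum exists in
every prime characteristic — the open problem, Abramovich–Temkin–Włodarczyk 2024 §1.9), every reduced
separated scheme of finite type over every perfect field of positive characteristic admits a
resolution of singularities. This is the residue of line `datum-glued-split` of crux stmt-0569 after
RESHAPE 5: nothing else is open. [cite: Wlodarczyk2022, Thm 1.1.6; BerghRydh2019, Thm 5;
AbramovichTemkinWlodarczyk2024, Thm 1.1.1 and §1.9] -/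
theorem weightedThesis_of_berghRydh2019 : Literature.AlgebraicGeometry.Resolution.BerghRydh2019_diagonalizableQuotientResolution → Summit.ResolutionOfSingularities.ResolutionOfSingularities.Theses.WeightedInvariant.WeightedConstruction → Summit.ResolutionOfSingularities.ResolutionOfSingularities.Theses.WeightedInvariant.WeightedThesis := by
  intro hBR hC p hp k _ _ _ X f hs hl hq hr
  obtain ⟨D⟩ := hC p hp
  exact hasResolution_of_berghRydh2019_of_datum hBR hp D k X f

/-- **The summit modulo `WeightedConstruction`, Bergh–Rydh and descent**: the route's deciding theorem
`closes` fed with `datumToEmbedded_of_berghRydh2019` — resolution of singularities in every positive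
characteristic follows from the construction crux `WeightedConstruction` (stmt-0571), the published
Bergh–Rydh theorem, and the shared descent crux `DescentPerfectToAll` (stmt-0549: perfect ground
fields ⇒ all ground fields of characteristic `p`). [cite: Wlodarczyk2022, Thm 1.1.6; BerghRydh2019,
Thm 5; AbramovichTemkinWlodarczyk2024, §1.9] -/
theorem resolutionOfSingularities_of_berghRydh2019
    (hBR : BerghRydh2019_diagonalizableQuotientResolution) (hC : WeightedConstruction)
    (hD : DescentPerfectToAll) : _root_.ResolutionOfSingularities :=
  closes hC (datumToEmbedded_of_berghRydh2019 hBR) hD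

/-! ## Conversely: the recorded Bergh–Rydh statement follows from the crux (and Hironaka)

Appended by lead c4 (same session): the named fact is recorded in the WEAK form "`Scheme.HasResolution X`
for integral separated finite-type `X` over a perfect field admitting étale charts by diagonalizable
quotients" — and every such `X` is in particular reduced, separated and of finite type over a field
whose characteristic is `0` or a prime. So the recorded fact is a CONSEQUENCE of resolution in every
characteristic: of `Hironaka1964` (characteristic `0`, named fact) and of the crux `WeightedThesis`
(prime characteristic, perfect ground fields). Hence, granted the construction crux and Hironaka, the
crux is EQUIVALENT to the recorded Bergh–Rydh statement (`weightedThesis_iff_berghRydh2019`): the named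
fact in the residue of line `datum-glued-split` is not removable by a cleverer assembly short of
proving the crux itself, and it costs nothing beyond the crux. -/

/-- **The recorded Bergh–Rydh statement follows from Hironaka and the crux**: an integral separated
scheme of finite type over a perfect field `k` is reduced, and `k` has characteristic `0` (resolve by
`Hironaka1964`) or a prime `p` (resolve by `WeightedThesis`); the étale quotient charts in the
hypothesis of `BerghRydh2019_diagonalizableQuotientResolution` are not used. [folklore] -/
theorem berghRydh2019_of_hironaka_of_weightedThesis : Literature.AlgebraicGeometry.Resolution.Hironaka1964.{0} → Summit.ResolutionOfSingularities.ResolutionOfSingularities.Theses.WeightedInvariant.WeightedThesis → Literature.AlgebraicGeometry.Resolution.BerghRydh2019_diagonalizableQuotientResolution := by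
  intro hH hT k _ _ X g _ _ _ _ _
  obtain ⟨p, hp⟩ := CharP.exists k
  rcases CharP.char_is_prime_or_zero k p with hprime | rfl
  · exact hT p hprime k X g ‹_› ‹_› ‹_› inferInstance
  · exact hH k X g ‹_› ‹_› ‹_› inferInstance

/-- **Granted the construction crux and Hironaka, the crux `WeightedThesis` is EQUIVALENT to the
recorded Bergh–Rydh statement** (resolution of finite diagonalizable quotient singularities over
perfect fields, arXiv:1905.00872 Thm 5 in the tree's weak form): `←` is
`weightedThesis_of_berghRydh2019` (Włodarczyk's cobordant tower + torus quotient, crux stmt-0572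
landed modulo the fact), `→` is `berghRydh2019_of_hironaka_of_weightedThesis`. So the residue of crux
stmt-0569 along route WeightedInvariant is exactly {`WeightedConstruction` (stmt-0571), Bergh–Rydh},
and the second member is implied by the crux. [cite: BerghRydh2019, Thm 5; Wlodarczyk2022, Thm 1.1.6;
Hironaka1964, Main Theorem I] -/
theorem weightedThesis_iff_berghRydh2019 : Literature.AlgebraicGeometry.Resolution.Hironaka1964.{0} → Summit.ResolutionOfSingularities.ResolutionOfSingularities.Theses.WeightedInvariant.WeightedConstruction → (Summit.ResolutionOfSingularities.ResolutionOfSingularities.Theses.WeightedInvariant.WeightedThesis ↔ Literature.AlgebraicGeometry.Resolution.BerghRydh2019_diagonalizableQuotientResolution) :=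
  fun hH hC => ⟨berghRydh2019_of_hironaka_of_weightedThesis hH,
    fun hBR => weightedThesis_of_berghRydh2019 hBR hC⟩

end Summit.ResolutionOfSingularities.ResolutionOfSingularities.Theorems

end
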